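import Literature.InformationTheory.StateDiscrimination.PureStateQuantumGeometricTensor
import Literature.InformationTheory.StateDiscrimination.QuantumFisherMatrixCovarianceBound
import Literature.Probability.Divergences.FisherInformationMatrix
import HarnessLib

/-!
# Projective measurements on a pure state: the gap `uᵀF_Qu − uᵀFu = 4Σ_k Im(⟨Υ_k|Ψ_u⟩⟨ψ|Υ_k⟩)²/|⟨Υ_k|ψ⟩|²`
# and the saturation criterion `F = F_Q ⇔ Im(⟨∂_lψ|Υ_k⟩⟨Υ_k|ψ⟩) = |⟨ψ|Υ_k⟩|² Im⟨∂_lψ|ψ⟩`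
# (Pezzè–Ciampini–Spagnolo–Humphreys–Datta–Walmsley–Barbieri–Sciarrino–Smerzi 2017, Theorem 2 and its proof;
# Liu–Yuan–Lu–Wang 2020 Thm 3.4)

Hodge foundations lane (`lit-hodgefound`, prover p24 gen 80; quantum-information series).  THEOREMS ONLY: no
definition, no named fact, net debt 0.  Pure-state vocabulary of g78/g80-#1/#5: a unit vector `ψ`, derivative
vectors `ψ' l = |∂_lψ⟩` with `⟨ψ|∂_lψ⟩ + ⟨∂_lψ|ψ⟩ = 0`, and a projective measurement given by a unitary `W`
(`W†W = WW† = 1`) whose columns are the projectors' vectors `|Υ_k⟩`, so that `⟨Υ_k|v⟩ = (W†v)_k`,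
`P(k) = |⟨Υ_k|ψ⟩|²`, `∂_lP(k) = 2Re(⟨Υ_k|∂_lψ⟩⟨ψ|Υ_k⟩)`; the classical Fisher matrix of the outcome law is the
hypothesis `hI : I l m = Σ_k ∂_lP(k)∂_mP(k)/P(k)` (the shape of `Probability/Divergences/FisherInformationMatrix.lean`,
p24 g80-#7) and the QFIM is `hF : F l m = 4Re(⟨∂_lψ|∂_mψ⟩ − ⟨∂_lψ|ψ⟩⟨ψ|∂_mψ⟩)` (g80-#1 `qfim_pure`); the printed
`|ω_l⟩ := |∂_lψ⟩ + |ψ⟩⟨∂_lψ|ψ⟩` is `S_l|ψ⟩` (g80-#5 `sld_mulVec_pure`).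

## Source, VERBATIM

L. Pezzè, M. A. Ciampini, N. Spagnolo, P. C. Humphreys, A. Datta, I. A. Walmsley, M. Barbieri, F. Sciarrino,
A. Smerzi, *Optimal measurements for simultaneous quantum estimation of multiple phases*, Phys. Rev. Lett. 119
(2017) 130504 [PezzeEtAl2017], held `paper:arxiv-1705.03687`.  p0003: «`P(k|θ) = ⟨ψ_θ|Π̂_k|ψ_θ⟩` …
`[F(θ)]_{l,m} = Σ_k ∂_lP(k|θ)∂_mP(k|θ)/P(k|θ)` is the `d × d` symmetric Fisher information matrix (FIM) … Since
`∂_lP(k|θ) = 2Re[⟨∂_lψ_θ|Π̂_k|ψ_θ⟩]` …».  p0005: «**Theorem 2 (Projective measurement not orthogonal to the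
probe)**: Let us consider a probe pure state `|ψ_θ⟩` and a set of projectors `{|Υ_k⟩⟨Υ_k|}_k` not orthogonal to
the probe (i.e. `⟨Υ_k|ψ_θ⟩ ≠ 0` for all `k`). The equality `F(θ) = F_Q(θ)` holds if and only if
`Im[⟨∂_lψ_θ|Υ_k⟩⟨Υ_k|ψ_θ⟩] = |⟨ψ_θ|Υ_k⟩|² Im[⟨∂_lψ_θ|ψ_θ⟩]`, for all `l = 1,2,...,d` and all `k`.»  Proof
(p0010, «2 Proof of theorem #2»): «The FIM … can be rewritten as
`[F(θ)]_{l,m} = 4Σ_k Re[⟨ω_l|Υ_k⟩⟨Υ_k|ψ_θ⟩]Re[⟨ω_m|Υ_k⟩⟨Υ_k|ψ_θ⟩]/|⟨Υ_k|ψ_θ⟩|²`, where we have introduced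
`|ω_j⟩ ≡ |∂_jψ_θ⟩ + |ψ_θ⟩⟨∂_jψ_θ|ψ_θ⟩`, and used `Re[⟨ω_j|Υ_k⟩⟨Υ_k|ψ_θ⟩] = Re[⟨∂_jψ_θ|Υ_k⟩⟨Υ_k|ψ_θ⟩]`, that holds
since `Re[⟨ψ_θ|∂_jψ_θ⟩] = 0`. … `uᵀF(θ)u = 4Σ_k(Re[⟨Ψ_u|Υ_k⟩⟨Υ_k|ψ_θ⟩])²/|⟨Υ_k|ψ_θ⟩|²`, where
`|Ψ_u⟩ ≡ Σ_l u_l|ω_l⟩`. … we use `Re[x]² = |x|² − Im[x]²`, giving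
`uᵀF(θ)u = 4Σ_k|⟨Ψ_u|Υ_k⟩|² − 4Σ_k(Im[⟨Ψ_u|Υ_k⟩⟨Υ_k|ψ_θ⟩])²/|⟨Υ_k|ψ_θ⟩|² = uᵀF_Q(θ)u − 4Σ_k(Im[…])²/|⟨Υ_k|ψ_θ⟩|²`,
where `Σ_k|Υ_k⟩⟨Υ_k| = 𝟙` and `4Σ_k⟨Ψ_u|Υ_k⟩⟨Υ_k|Ψ_u⟩ = 4⟨Ψ_u|Ψ_u⟩ = uᵀF_Q(θ)u`. Since `|⟨Υ_k|ψ_θ⟩|² ≠ 0` for all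
`k`, the saturation … is obtained if and only if `Im[⟨Ψ_u|Υ_k⟩⟨Υ_k|ψ_θ⟩] = Σ_l Im[⟨ω_l|Υ_k⟩⟨Υ_k|ψ_θ⟩]u_l = 0 ∀k`.
Since this equality must be satisfied for all possible choices of `u`, the necessary and sufficient condition is
`Im[⟨ω_l|Υ_k⟩⟨Υ_k|ψ_θ⟩] = 0 ∀l,k` or, equivalently, `Im[⟨∂_lψ_θ|Υ_k⟩⟨Υ_k|ψ_θ⟩] − |⟨ψ_θ|Υ_k⟩|²Im[⟨∂_lψ_θ|ψ_θ⟩] = 0`.»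
Restated as Liu–Yuan–Lu–Wang 2020 Thm 3.4 [LiuYuanLuWang2020, §3.1.3 Thm 3.4 («[Pezze2017]»)].

## What is formalized (all PROVED; the printed proof, step by step)

* § 1 amplitudes: `conjTranspose_mulVec_apply` (`(W†v)_k = ⟨Υ_k|v⟩`), `sum_star_amp_mul_amp` (completeness
  `Σ_k ⟨u|Υ_k⟩⟨Υ_k|v⟩ = ⟨u|v⟩`), `sum_normSq_amp` (`Σ_k|⟨Υ_k|ψ⟩|² = 1`), `re_inner_deriv_psi` (`Re⟨∂ψ|ψ⟩ = 0`),
  `re_amp_omega_mul` (the printed `Re[⟨ω_j|Υ_k⟩⟨Υ_k|ψ⟩] = Re[⟨∂_jψ|Υ_k⟩⟨Υ_k|ψ⟩]`), `inner_omega_omega`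
  (`⟨ω_l|ω_m⟩ = ⟨∂_lψ|∂_mψ⟩ − ⟨∂_lψ|ψ⟩⟨ψ|∂_mψ⟩`).
* § 2 the engine: `gap_identity_scalar` (`4(Σ|w_k|² − |c|²) − Σ(2Re z_k)²/p_k = 4Σ(Im z_k − p_kIm c)²/p_k` for
  amplitudes `z_k = w_k s̄_k`, `p_k = |s_k|² ≠ 0`, `Σp = 1`, `c = Σ s̄_kw_k`, `Re c = 0`).
* § 3 quadratic forms: `dotProduct_projFisher_mulVec` (`uᵀFu`), `dotProduct_qfimPure_mulVec` (`uᵀF_Qu = 4‖Ψ_u‖²`),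
  **`qfim_sub_projFisher_quadratic`** (the printed identity
  `uᵀF_Qu − uᵀFu = 4Σ_k(Im[⟨Υ_k|Ψ_u⟩⟨ψ|Υ_k⟩])²/|⟨Υ_k|ψ⟩|²`), **`qfim_sub_projFisher_posSemidef`** (`F ≤ F_Q`).
* § 4 **`projFisher_eq_qfim_iff`** (THEOREM 2: `F = F_Q ⇔ ∀ l k, Im[⟨Υ_k|ω_l⟩⟨ψ|Υ_k⟩] = 0`),
  **`projFisher_eq_qfim_iff'`** (the printed form `Im[⟨∂_lψ|Υ_k⟩⟨Υ_k|ψ⟩] = |⟨ψ|Υ_k⟩|²Im[⟨∂_lψ|ψ⟩]`).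
* § 5 bridges: `re_trace_pure_mul_proj` / `re_trace_deriv_mul_proj` (the Born probabilities and their derivatives
  for `ρ = |ψ⟩⟨ψ|`, `Π_k = |Υ_k⟩⟨Υ_k|`, matching the CFIM of g80-#2), `qfim_pure_eq` (the SLD-QFIM is `F_Q`).
* § 6 (Appendix § 2.1, «Consistency with Matsumoto's condition»): **`im_inner_omega_omega_eq_zero`** (the
  condition of Theorem 2 forces `Im⟨ω_l|ω_m⟩ = 0`), **`im_inner_deriv_deriv_eq_zero`** (hence Matsumoto's weak
  commutativity `Im⟨∂_lψ|∂_mψ⟩ = 0`) — by a shorter road than the printed case analysis: each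
  `⟨ω_l|Υ_k⟩⟨Υ_k|ω_m⟩ = z̄_{lk}z_{mk}/|⟨Υ_k|ψ⟩|²` with `z_{lk} = ⟨Υ_k|ω_l⟩⟨ψ|Υ_k⟩` real.

NOT formalized: Theorem 1 / Theorem 3 (projectors orthogonal to the probe — a `0/0` limit), Corollary 2
(Gram–Schmidt construction).  Tree
search (FAIL-DUP, 2026-09-01): `rg -il "Pezz|optimal measurement|projective measurement" Literature/InformationTheory`
→ only docstring mentions in the g78–g80 files; the one-parameter pure-state saturation is g78 `QFI.fisherInfo_…`.
-/

noncomputable section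

open Matrix Finset
open scoped ComplexConjugate ComplexOrder

namespace Literature.InformationTheory.StateDiscrimination.PureProjective

open Literature.InformationTheory.StateDiscrimination.PureQGT (star_inner_deriv qfim_eq_four_re_qgt)
open Literature.InformationTheory.StateDiscrimination.QFIMCovariance (ext_of_dotProduct_mulVec_eq)
open Literature.Probability.Divergences.FisherMatrix (dotProduct_fisherMatrix_mulVec fisherMatrix_isHermitian)

variable {n ι : Type*} [Fintype n] [DecidableEq n] [Fintype ι]

/-- `z z̄ = |z|²`. [folklore] -/
private theorem mul_star_self (z : ℂ) : z * star z = (Complex.normSq z : ℂ) := by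
  rw [Complex.star_def, Complex.mul_conj]

/-! ## § 1 Amplitudes in the measurement basis -/

omit [DecidableEq n] in
/-- `(W†v)_k = Σ_j W̄_{jk} v_j = ⟨Υ_k|v⟩` for the `k`-th column `Υ_k` of `W`. [cite: PezzeEtAl2017, (3) («`P(k|θ) = ⟨ψ_θ|Π̂_k|ψ_θ⟩`»)] -/
theorem conjTranspose_mulVec_apply (W : Matrix n n ℂ) (v : n → ℂ) (k : n) :
    (Wᴴ *ᵥ v) k = star (fun j => W j k) ⬝ᵥ v := by
  simp [mulVec, dotProduct, conjTranspose_apply]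

/-- **Completeness `Σ_k|Υ_k⟩⟨Υ_k| = 𝟙`**: `Σ_k conj⟨Υ_k|u⟩·⟨Υ_k|v⟩ = ⟨u|v⟩` for `WW† = 1`. [cite: PezzeEtAl2017, Appendix proof of Thm 2 («where `Σ_k|Υ_k⟩⟨Υ_k| = 𝟙`»)] -/
theorem sum_star_amp_mul_amp {W : Matrix n n ℂ} (hW' : W * Wᴴ = 1) (u v : n → ℂ) :
    ∑ k, star ((Wᴴ *ᵥ u) k) * (Wᴴ *ᵥ v) k = star u ⬝ᵥ v := by
  change star (Wᴴ *ᵥ u) ⬝ᵥ (Wᴴ *ᵥ v) = _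
  rw [star_mulVec, conjTranspose_conjTranspose, ← dotProduct_mulVec, mulVec_mulVec, hW', one_mulVec]

/-- `Σ_k P(k) = Σ_k|⟨Υ_k|ψ⟩|² = ⟨ψ|ψ⟩ = 1`. [cite: PezzeEtAl2017, (3)] -/
theorem sum_normSq_amp {W : Matrix n n ℂ} (hW' : W * Wᴴ = 1) {ψ : n → ℂ} (hψ : star ψ ⬝ᵥ ψ = 1) :
    ∑ k, Complex.normSq ((Wᴴ *ᵥ ψ) k) = 1 := by
  have h := sum_star_amp_mul_amp hW' ψ ψ
  rw [hψ] at h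
  have h' : ((∑ k, Complex.normSq ((Wᴴ *ᵥ ψ) k) : ℝ) : ℂ) = 1 := by
    rw [← h, Complex.ofReal_sum]
    exact Finset.sum_congr rfl fun k _ => by rw [Complex.star_def, Complex.normSq_eq_conj_mul_self]
  exact_mod_cast h'

omit [DecidableEq n] in
/-- `Re⟨∂_lψ|ψ⟩ = 0` (and `Re⟨ψ|∂_lψ⟩ = 0`) from `⟨ψ|∂_lψ⟩ + ⟨∂_lψ|ψ⟩ = 0`. [cite: PezzeEtAl2017, Appendix proof of Thm 2 («since `Re[⟨ψ_θ|∂_jψ_θ⟩] = 0`»)] -/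
theorem re_inner_deriv_psi {ψ ψ' : n → ℂ} (hre : star ψ ⬝ᵥ ψ' + star ψ' ⬝ᵥ ψ = 0) :
    (star ψ' ⬝ᵥ ψ).re = 0 ∧ (star ψ ⬝ᵥ ψ').re = 0 := by
  obtain ⟨hs, hn⟩ := star_inner_deriv hre
  have h1 : (star ψ' ⬝ᵥ ψ).re = (star ψ ⬝ᵥ ψ').re := by
    rw [← hs, Complex.star_def, Complex.conj_re]
  have h2 : (star ψ' ⬝ᵥ ψ).re = -(star ψ ⬝ᵥ ψ').re := by rw [hn, Complex.neg_re]
  constructor <;> linarith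

omit [DecidableEq n] in
/-- **`Re[⟨Υ_k|ω_j⟩⟨ψ|Υ_k⟩] = Re[⟨Υ_k|∂_jψ⟩⟨ψ|Υ_k⟩]`** for `|ω_j⟩ = |∂_jψ⟩ + ⟨∂_jψ|ψ⟩|ψ⟩` (the extra term is
`⟨∂_jψ|ψ⟩|⟨Υ_k|ψ⟩|²`, purely imaginary). [cite: PezzeEtAl2017, Appendix proof of Thm 2 (the display after the definition of `|ω_j⟩`)] -/
theorem re_amp_omega_mul (W : Matrix n n ℂ) {ψ ψ' : n → ℂ} (hre : star ψ ⬝ᵥ ψ' + star ψ' ⬝ᵥ ψ = 0) (k : n) :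
    ((Wᴴ *ᵥ (ψ' + (star ψ' ⬝ᵥ ψ) • ψ)) k * star ((Wᴴ *ᵥ ψ) k)).re =
      ((Wᴴ *ᵥ ψ') k * star ((Wᴴ *ᵥ ψ) k)).re := by
  rw [mulVec_add, mulVec_smul, Pi.add_apply, Pi.smul_apply, smul_eq_mul, add_mul, mul_assoc, mul_star_self,
    Complex.add_re, Complex.re_mul_ofReal, (re_inner_deriv_psi hre).1, zero_mul, add_zero]

omit [DecidableEq n] in
/-- **`⟨ω_l|ω_m⟩ = ⟨∂_lψ|∂_mψ⟩ − ⟨∂_lψ|ψ⟩⟨ψ|∂_mψ⟩`** (the quantum geometric tensor; so `4Re⟨ω_l|ω_m⟩ = [F_Q]_{lm}`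
and `4⟨Ψ_u|Ψ_u⟩ = uᵀF_Qu`). [cite: PezzeEtAl2017, Appendix proof of Thm 2 («`4⟨Ψ_u|Ψ_u⟩ = uᵀF_Q(θ)u`»)] -/
theorem inner_omega_omega {ψ : n → ℂ} (hψ : star ψ ⬝ᵥ ψ = 1) {ψ'₁ ψ'₂ : n → ℂ}
    (h₁ : star ψ ⬝ᵥ ψ'₁ + star ψ'₁ ⬝ᵥ ψ = 0) (h₂ : star ψ ⬝ᵥ ψ'₂ + star ψ'₂ ⬝ᵥ ψ = 0) :
    star (ψ'₁ + (star ψ'₁ ⬝ᵥ ψ) • ψ) ⬝ᵥ (ψ'₂ + (star ψ'₂ ⬝ᵥ ψ) • ψ) =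
      star ψ'₁ ⬝ᵥ ψ'₂ - (star ψ'₁ ⬝ᵥ ψ) * (star ψ ⬝ᵥ ψ'₂) := by
  obtain ⟨hs1, hn1⟩ := star_inner_deriv h₁
  obtain ⟨hs2, hn2⟩ := star_inner_deriv h₂
  have h1a : star (star ψ'₁ ⬝ᵥ ψ) = star ψ ⬝ᵥ ψ'₁ := by rw [← hs1, star_star]
  simp only [star_add, star_smul, add_dotProduct, dotProduct_add, smul_dotProduct, dotProduct_smul, smul_eq_mul, hψ,
    mul_one]
  rw [h1a, hn1, hn2]
  ring

/-! ## § 2 The scalar engine: `Re[x]² = |x|² − Im[x]²` summed over the outcomes -/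

/-- **The engine of the proof of Theorem 2**: for amplitudes `s_k = ⟨Υ_k|ψ⟩ ≠ 0` with `Σ_k|s_k|² = 1`,
`w_k = ⟨Υ_k|∂ψ⟩`, `c = Σ_k s̄_kw_k` (`= ⟨ψ|∂ψ⟩`) with `Re c = 0`, and `z_k = w_ks̄_k` (`½∂P(k) = Re z_k`):
`4(Σ_k|w_k|² − |c|²) − Σ_k(2Re z_k)²/|s_k|² = 4Σ_k(Im z_k − |s_k|²Im c)²/|s_k|²`.
[cite: PezzeEtAl2017, Appendix proof of Thm 2 («we use `Re[x]² = |x|² − Im[x]²`»)] -/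
theorem gap_identity_scalar {K : Type*} [Fintype K] {s w : K → ℂ} (hs : ∀ k, s k ≠ 0)
    (hs1 : ∑ k, Complex.normSq (s k) = 1) {c : ℂ} (hc : c = ∑ k, star (s k) * w k) (hcre : c.re = 0) :
    4 * (∑ k, Complex.normSq (w k) - Complex.normSq c) -
        ∑ k, (2 * (w k * star (s k)).re) * (2 * (w k * star (s k)).re) / Complex.normSq (s k) =
      4 * ∑ k, ((w k * star (s k)).im - Complex.normSq (s k) * c.im) ^ 2 / Complex.normSq (s k) := by
  -- `|w_k|² = (Re z_k² + Im z_k²)/p_k`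
  have hw : ∀ k, Complex.normSq (w k) =
      ((w k * star (s k)).re ^ 2 + (w k * star (s k)).im ^ 2) / Complex.normSq (s k) := fun k => by
    have hp : Complex.normSq (s k) ≠ 0 := (Complex.normSq_pos.mpr (hs k)).ne'
    rw [eq_div_iff hp, sq, sq, ← Complex.normSq_apply, Complex.normSq_mul, Complex.star_def, Complex.normSq_conj]
  -- `Im c = Σ_k Im z_k`… with a sign: `c = Σ s̄w` and `z = w s̄`, so `Im c = Σ Im z_k`
  have hcim : c.im = ∑ k, (w k * star (s k)).im := by
    rw [hc, Complex.im_sum]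
    exact Finset.sum_congr rfl fun k _ => by rw [mul_comm]
  -- `|c|² = (Im c)²`
  have hcn : Complex.normSq c = c.im ^ 2 := by rw [Complex.normSq_apply, hcre]; ring
  -- expand the square on the right
  have hrhs : ∀ k, ((w k * star (s k)).im - Complex.normSq (s k) * c.im) ^ 2 / Complex.normSq (s k) =
      (w k * star (s k)).im ^ 2 / Complex.normSq (s k) - 2 * c.im * (w k * star (s k)).im +
        c.im ^ 2 * Complex.normSq (s k) := fun k => by
    have hp : Complex.normSq (s k) ≠ 0 := (Complex.normSq_pos.mpr (hs k)).ne'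
    field_simp
    ring
  have hlhs : ∀ k, (2 * (w k * star (s k)).re) * (2 * (w k * star (s k)).re) / Complex.normSq (s k) =
      4 * ((w k * star (s k)).re ^ 2 / Complex.normSq (s k)) := fun k => by ring
  simp_rw [hrhs, hlhs, hw, Finset.sum_add_distrib, Finset.sum_sub_distrib, ← Finset.mul_sum, hs1, ← hcim, hcn,
    add_div, Finset.sum_add_distrib]
  ring

/-! ## § 3 The quadratic forms `uᵀFu`, `uᵀF_Qu` and the printed gap identity -/

omit [DecidableEq n] in
/-- **`uᵀFu = 4Σ_k(Re[⟨Υ_k|∂_uψ⟩⟨ψ|Υ_k⟩])²/P(k)`** with `∂_uψ = Σ_l u_l∂_lψ` (bilinearity of the Fisher matrix of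
the outcome law `P(k) = |⟨Υ_k|ψ⟩|²`, `∂_lP(k) = 2Re[⟨Υ_k|∂_lψ⟩⟨ψ|Υ_k⟩]`). [cite: PezzeEtAl2017, Appendix proof of Thm 2 («`uᵀF(θ)u = 4Σ_k(Re[⟨Ψ_u|Υ_k⟩⟨Υ_k|ψ_θ⟩])²/|⟨Υ_k|ψ_θ⟩|²`»)] -/
theorem dotProduct_projFisher_mulVec (W : Matrix n n ℂ) (ψ : n → ℂ) (ψ' : ι → n → ℂ) {I : Matrix ι ι ℝ}
    (hI : ∀ l m, I l m = ∑ k, (2 * ((Wᴴ *ᵥ ψ' l) k * star ((Wᴴ *ᵥ ψ) k)).re) *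
      (2 * ((Wᴴ *ᵥ ψ' m) k * star ((Wᴴ *ᵥ ψ) k)).re) / Complex.normSq ((Wᴴ *ᵥ ψ) k)) (u : ι → ℝ) :
    u ⬝ᵥ (I *ᵥ u) = ∑ k, (2 * ((Wᴴ *ᵥ (∑ l, (u l : ℂ) • ψ' l)) k * star ((Wᴴ *ᵥ ψ) k)).re) *
      (2 * ((Wᴴ *ᵥ (∑ l, (u l : ℂ) • ψ' l)) k * star ((Wᴴ *ᵥ ψ) k)).re) / Complex.normSq ((Wᴴ *ᵥ ψ) k) := by
  rw [dotProduct_fisherMatrix_mulVec hI u u]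
  have hlin : ∀ k, 2 * ((Wᴴ *ᵥ (∑ l, (u l : ℂ) • ψ' l)) k * star ((Wᴴ *ᵥ ψ) k)).re =
      ∑ l, u l * (2 * ((Wᴴ *ᵥ ψ' l) k * star ((Wᴴ *ᵥ ψ) k)).re) := fun k => by
    rw [mulVec_sum, Finset.sum_apply, Finset.sum_mul, Complex.re_sum, Finset.mul_sum]
    refine Finset.sum_congr rfl fun l _ => ?_
    rw [mulVec_smul, Pi.smul_apply, smul_eq_mul, mul_assoc, Complex.re_ofReal_mul]
    ring
  simp_rw [hlin]

omit [DecidableEq n] in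
/-- **`uᵀF_Qu = 4⟨Ψ_u|Ψ_u⟩ = 4(‖∂_uψ‖² − |⟨ψ|∂_uψ⟩|²)`** for `[F_Q]_{lm} = 4Re(⟨∂_lψ|∂_mψ⟩ − ⟨∂_lψ|ψ⟩⟨ψ|∂_mψ⟩)`.
[cite: PezzeEtAl2017, Appendix proof of Thm 2 («`4⟨Ψ_u|Ψ_u⟩ = uᵀF_Q(θ)u`»)] -/
theorem dotProduct_qfimPure_mulVec (ψ : n → ℂ) (ψ' : ι → n → ℂ) {F : Matrix ι ι ℝ}
    (hF : ∀ l m, F l m = 4 * (star (ψ' l) ⬝ᵥ ψ' m - (star (ψ' l) ⬝ᵥ ψ) * (star ψ ⬝ᵥ ψ' m)).re) (u : ι → ℝ) :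
    u ⬝ᵥ (F *ᵥ u) = 4 * (star (∑ l, (u l : ℂ) • ψ' l) ⬝ᵥ (∑ l, (u l : ℂ) • ψ' l) -
      (star (∑ l, (u l : ℂ) • ψ' l) ⬝ᵥ ψ) * (star ψ ⬝ᵥ (∑ l, (u l : ℂ) • ψ' l))).re := by
  -- bilinear expansions
  have h1 : star (∑ l, (u l : ℂ) • ψ' l) ⬝ᵥ (∑ m, (u m : ℂ) • ψ' m) =
      ∑ l, ∑ m, (u l : ℂ) * (u m : ℂ) * (star (ψ' l) ⬝ᵥ ψ' m) := by
    simp only [star_sum, star_smul, Complex.star_def, Complex.conj_ofReal, sum_dotProduct, smul_dotProduct,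
      dotProduct_sum, dotProduct_smul, smul_eq_mul, Finset.mul_sum]
    rw [Finset.sum_comm]
    exact Finset.sum_congr rfl fun l _ => Finset.sum_congr rfl fun m _ => by ring
  have h2 : star (∑ l, (u l : ℂ) • ψ' l) ⬝ᵥ ψ = ∑ l, (u l : ℂ) * (star (ψ' l) ⬝ᵥ ψ) := by
    simp only [star_sum, star_smul, Complex.star_def, Complex.conj_ofReal, sum_dotProduct, smul_dotProduct, smul_eq_mul]
  have h3 : star ψ ⬝ᵥ (∑ l, (u l : ℂ) • ψ' l) = ∑ l, (u l : ℂ) * (star ψ ⬝ᵥ ψ' l) := by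
    simp only [dotProduct_sum, dotProduct_smul, smul_eq_mul]
  have hbil : star (∑ l, (u l : ℂ) • ψ' l) ⬝ᵥ (∑ l, (u l : ℂ) • ψ' l) -
      (star (∑ l, (u l : ℂ) • ψ' l) ⬝ᵥ ψ) * (star ψ ⬝ᵥ (∑ l, (u l : ℂ) • ψ' l)) =
      ∑ l, ∑ m, (u l : ℂ) * (u m : ℂ) * (star (ψ' l) ⬝ᵥ ψ' m - (star (ψ' l) ⬝ᵥ ψ) * (star ψ ⬝ᵥ ψ' m)) := by
    rw [h1, h2, h3, Finset.sum_mul_sum, ← Finset.sum_sub_distrib]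
    refine Finset.sum_congr rfl fun l _ => ?_
    rw [← Finset.sum_sub_distrib]
    exact Finset.sum_congr rfl fun m _ => by ring
  rw [hbil, Complex.re_sum, Finset.mul_sum]
  simp only [dotProduct, mulVec, hF, Finset.mul_sum, Complex.re_sum]
  refine Finset.sum_congr rfl fun l _ => Finset.sum_congr rfl fun m _ => ?_
  rw [← Complex.ofReal_mul, Complex.re_ofReal_mul]
  ring

omit [DecidableEq n] in
/-- The normalisation condition is linear: `⟨ψ|∂_uψ⟩ + ⟨∂_uψ|ψ⟩ = 0` for `∂_uψ = Σ u_l∂_lψ`, real `u`. [cite: PezzeEtAl2017, Appendix proof of Thm 2 («`|Ψ_u⟩ ≡ Σ_l u_l|ω_l⟩`»)] -/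
theorem re_inner_sum_smul {ψ : n → ℂ} {ψ' : ι → n → ℂ} (hre : ∀ l, star ψ ⬝ᵥ ψ' l + star (ψ' l) ⬝ᵥ ψ = 0)
    (u : ι → ℝ) :
    star ψ ⬝ᵥ (∑ l, (u l : ℂ) • ψ' l) + star (∑ l, (u l : ℂ) • ψ' l) ⬝ᵥ ψ = 0 := by
  simp only [star_sum, star_smul, sum_dotProduct, dotProduct_sum, smul_dotProduct, dotProduct_smul, smul_eq_mul,
    Complex.star_def, Complex.conj_ofReal, ← Finset.sum_add_distrib, ← mul_add, hre, mul_zero, Finset.sum_const_zero]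

/-- **The printed gap identity**: for a unit `ψ`, derivative vectors with `⟨ψ|∂_lψ⟩ + ⟨∂_lψ|ψ⟩ = 0`, a unitary
`W` with `⟨Υ_k|ψ⟩ ≠ 0` for all `k`, the outcome Fisher matrix `F` (hypothesis `hI`) and the pure-state QFIM `F_Q`
(hypothesis `hF`): `uᵀF_Qu − uᵀFu = 4Σ_k(Im[⟨Υ_k|Ψ_u⟩⟨ψ|Υ_k⟩])²/|⟨Υ_k|ψ⟩|²` with
`|Ψ_u⟩ = ∂_uψ + ⟨∂_uψ|ψ⟩ψ = Σ_l u_l|ω_l⟩`. [cite: PezzeEtAl2017, Appendix proof of Thm 2 (the display `uᵀF(θ)u = uᵀF_Q(θ)u − 4Σ_k(Im[⟨Ψ_u|Υ_k⟩⟨Υ_k|ψ_θ⟩])²/|⟨Υ_k|ψ_θ⟩|²`)] -/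
theorem qfim_sub_projFisher_quadratic {W : Matrix n n ℂ} (hW' : W * Wᴴ = 1) {ψ : n → ℂ} (hψ : star ψ ⬝ᵥ ψ = 1)
    (hp : ∀ k, (Wᴴ *ᵥ ψ) k ≠ 0) {ψ' : ι → n → ℂ} (hre : ∀ l, star ψ ⬝ᵥ ψ' l + star (ψ' l) ⬝ᵥ ψ = 0)
    {I F : Matrix ι ι ℝ}
    (hI : ∀ l m, I l m = ∑ k, (2 * ((Wᴴ *ᵥ ψ' l) k * star ((Wᴴ *ᵥ ψ) k)).re) *
      (2 * ((Wᴴ *ᵥ ψ' m) k * star ((Wᴴ *ᵥ ψ) k)).re) / Complex.normSq ((Wᴴ *ᵥ ψ) k))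
    (hF : ∀ l m, F l m = 4 * (star (ψ' l) ⬝ᵥ ψ' m - (star (ψ' l) ⬝ᵥ ψ) * (star ψ ⬝ᵥ ψ' m)).re) (u : ι → ℝ) :
    u ⬝ᵥ (F *ᵥ u) - u ⬝ᵥ (I *ᵥ u) =
      4 * ∑ k, ((Wᴴ *ᵥ ((∑ l, (u l : ℂ) • ψ' l) + (star (∑ l, (u l : ℂ) • ψ' l) ⬝ᵥ ψ) • ψ)) k *
        star ((Wᴴ *ᵥ ψ) k)).im ^ 2 / Complex.normSq ((Wᴴ *ᵥ ψ) k) := by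
  -- abbreviations: `∂_uψ`, its amplitudes `w`, the probe amplitudes `s`, `c = ⟨ψ|∂_uψ⟩`
  set φ : n → ℂ := ∑ l, (u l : ℂ) • ψ' l with hφ
  have hreφ : star ψ ⬝ᵥ φ + star φ ⬝ᵥ ψ = 0 := re_inner_sum_smul hre u
  have hc : star ψ ⬝ᵥ φ = ∑ k, star ((Wᴴ *ᵥ ψ) k) * (Wᴴ *ᵥ φ) k := (sum_star_amp_mul_amp hW' ψ φ).symm
  have hcre : (star ψ ⬝ᵥ φ).re = 0 := (re_inner_deriv_psi hreφ).2
  have hnorm : star φ ⬝ᵥ φ = ((∑ k, Complex.normSq ((Wᴴ *ᵥ φ) k) : ℝ) : ℂ) := by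
    rw [← sum_star_amp_mul_amp hW' φ φ, Complex.ofReal_sum]
    exact Finset.sum_congr rfl fun k _ => by rw [Complex.star_def, Complex.normSq_eq_conj_mul_self]
  obtain ⟨hsc, hnc⟩ := star_inner_deriv hreφ
  -- left side in scalar form
  have hL : u ⬝ᵥ (F *ᵥ u) = 4 * (∑ k, Complex.normSq ((Wᴴ *ᵥ φ) k) - Complex.normSq (star ψ ⬝ᵥ φ)) := by
    rw [dotProduct_qfimPure_mulVec ψ ψ' hF u, ← hφ, hnorm, hnc]
    simp only [Complex.sub_re, Complex.ofReal_re, neg_mul, Complex.neg_re, Complex.mul_re, Complex.normSq_apply, hcre]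
    ring
  have hR : u ⬝ᵥ (I *ᵥ u) = ∑ k, (2 * ((Wᴴ *ᵥ φ) k * star ((Wᴴ *ᵥ ψ) k)).re) *
      (2 * ((Wᴴ *ᵥ φ) k * star ((Wᴴ *ᵥ ψ) k)).re) / Complex.normSq ((Wᴴ *ᵥ ψ) k) := by
    rw [dotProduct_projFisher_mulVec W ψ ψ' hI u]
  -- the `ω`-amplitudes: `Im[(W†Ψ_u)_k s̄_k] = Im z_k + p_k Im⟨∂_uψ|ψ⟩ = Im z_k − p_k Im c`
  have hIm : ∀ k, ((Wᴴ *ᵥ (φ + (star φ ⬝ᵥ ψ) • ψ)) k * star ((Wᴴ *ᵥ ψ) k)).im =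
      ((Wᴴ *ᵥ φ) k * star ((Wᴴ *ᵥ ψ) k)).im - Complex.normSq ((Wᴴ *ᵥ ψ) k) * (star ψ ⬝ᵥ φ).im := fun k => by
    rw [mulVec_add, mulVec_smul, Pi.add_apply, Pi.smul_apply, smul_eq_mul, add_mul, mul_assoc, mul_star_self,
      Complex.add_im, Complex.im_mul_ofReal, hnc, Complex.neg_im]
    ring
  simp_rw [hIm]
  rw [hL, hR]
  exact gap_identity_scalar hp (sum_normSq_amp hW' hψ) hc hcre

omit [DecidableEq n] [Fintype ι] in
/-- Symmetry of the outcome Fisher matrix and of `F_Q`. [cite: PezzeEtAl2017, (3) («symmetric Fisher information matrix»)] -/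
theorem projFisher_isHermitian_and (W : Matrix n n ℂ) (ψ : n → ℂ) (ψ' : ι → n → ℂ)
    (hre : ∀ l, star ψ ⬝ᵥ ψ' l + star (ψ' l) ⬝ᵥ ψ = 0) {I F : Matrix ι ι ℝ}
    (hI : ∀ l m, I l m = ∑ k, (2 * ((Wᴴ *ᵥ ψ' l) k * star ((Wᴴ *ᵥ ψ) k)).re) *
      (2 * ((Wᴴ *ᵥ ψ' m) k * star ((Wᴴ *ᵥ ψ) k)).re) / Complex.normSq ((Wᴴ *ᵥ ψ) k))
    (hF : ∀ l m, F l m = 4 * (star (ψ' l) ⬝ᵥ ψ' m - (star (ψ' l) ⬝ᵥ ψ) * (star ψ ⬝ᵥ ψ' m)).re) :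
    I.IsHermitian ∧ F.IsHermitian := by
  refine ⟨fisherMatrix_isHermitian hI, Matrix.IsHermitian.ext fun l m => ?_⟩
  obtain ⟨Q, hQ⟩ : ∃ Q : Matrix ι ι ℂ, ∀ a b, Q a b = star (ψ' a) ⬝ᵥ ψ' b - (star (ψ' a) ⬝ᵥ ψ) * (star ψ ⬝ᵥ ψ' b) :=
    ⟨Matrix.of fun a b => _, fun _ _ => rfl⟩
  rw [star_trivial, hF, hF, ← hQ, ← hQ, PureQGT.qgt_conj_symm hre hQ l m, Complex.star_def, Complex.conj_re]

/-- **`F ≤ F_Q` for projective measurements on a pure state** (`F_Q − F ⪰ 0`, from the gap identity).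
[cite: PezzeEtAl2017, Appendix proof of Thm 2 («we demonstrate that `F(θ) ≤ F_Q(θ)`»)] -/
theorem qfim_sub_projFisher_posSemidef {W : Matrix n n ℂ} (hW' : W * Wᴴ = 1) {ψ : n → ℂ} (hψ : star ψ ⬝ᵥ ψ = 1)
    (hp : ∀ k, (Wᴴ *ᵥ ψ) k ≠ 0) {ψ' : ι → n → ℂ} (hre : ∀ l, star ψ ⬝ᵥ ψ' l + star (ψ' l) ⬝ᵥ ψ = 0)
    {I F : Matrix ι ι ℝ}
    (hI : ∀ l m, I l m = ∑ k, (2 * ((Wᴴ *ᵥ ψ' l) k * star ((Wᴴ *ᵥ ψ) k)).re) *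
      (2 * ((Wᴴ *ᵥ ψ' m) k * star ((Wᴴ *ᵥ ψ) k)).re) / Complex.normSq ((Wᴴ *ᵥ ψ) k))
    (hF : ∀ l m, F l m = 4 * (star (ψ' l) ⬝ᵥ ψ' m - (star (ψ' l) ⬝ᵥ ψ) * (star ψ ⬝ᵥ ψ' m)).re) :
    (F - I).PosSemidef := by
  obtain ⟨hIh, hFh⟩ := projFisher_isHermitian_and W ψ ψ' hre hI hF
  refine PosSemidef.of_dotProduct_mulVec_nonneg (hFh.sub hIh) fun u => ?_
  rw [star_trivial, sub_mulVec, dotProduct_sub, qfim_sub_projFisher_quadratic hW' hψ hp hre hI hF u]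
  exact mul_nonneg (by norm_num) (sum_nonneg fun k _ => div_nonneg (sq_nonneg _) (Complex.normSq_nonneg _))

/-! ## § 4 Theorem 2: the saturation criterion -/

/-- **Theorem 2 (Pezzè et al. 2017), `ω`-form**: under the hypotheses above, `F = F_Q` if and only if
`Im[⟨Υ_k|ω_l⟩⟨ψ|Υ_k⟩] = 0` for all `l, k`, where `|ω_l⟩ = |∂_lψ⟩ + ⟨∂_lψ|ψ⟩|ψ⟩`.
[cite: PezzeEtAl2017, Thm 2 and Appendix («the necessary and sufficient condition is `Im[⟨ω_l|Υ_k⟩⟨Υ_k|ψ_θ⟩] = 0 ∀l,k`»)] [cite: LiuYuanLuWang2020, §3.1.3 Thm 3.4] -/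
theorem projFisher_eq_qfim_iff [DecidableEq ι] {W : Matrix n n ℂ} (hW' : W * Wᴴ = 1) {ψ : n → ℂ}
    (hψ : star ψ ⬝ᵥ ψ = 1) (hp : ∀ k, (Wᴴ *ᵥ ψ) k ≠ 0) {ψ' : ι → n → ℂ}
    (hre : ∀ l, star ψ ⬝ᵥ ψ' l + star (ψ' l) ⬝ᵥ ψ = 0) {I F : Matrix ι ι ℝ}
    (hI : ∀ l m, I l m = ∑ k, (2 * ((Wᴴ *ᵥ ψ' l) k * star ((Wᴴ *ᵥ ψ) k)).re) *
      (2 * ((Wᴴ *ᵥ ψ' m) k * star ((Wᴴ *ᵥ ψ) k)).re) / Complex.normSq ((Wᴴ *ᵥ ψ) k))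
    (hF : ∀ l m, F l m = 4 * (star (ψ' l) ⬝ᵥ ψ' m - (star (ψ' l) ⬝ᵥ ψ) * (star ψ ⬝ᵥ ψ' m)).re) :
    I = F ↔ ∀ l k, ((Wᴴ *ᵥ (ψ' l + (star (ψ' l) ⬝ᵥ ψ) • ψ)) k * star ((Wᴴ *ᵥ ψ) k)).im = 0 := by
  obtain ⟨hIh, hFh⟩ := projFisher_isHermitian_and W ψ ψ' hre hI hF
  -- the `ω`-amplitude along a real direction `u` is linear in `u`
  have hlin : ∀ (u : ι → ℝ) (k : n),
      ((Wᴴ *ᵥ ((∑ l, (u l : ℂ) • ψ' l) + (star (∑ l, (u l : ℂ) • ψ' l) ⬝ᵥ ψ) • ψ)) k * star ((Wᴴ *ᵥ ψ) k)).im =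
      ∑ l, u l * ((Wᴴ *ᵥ (ψ' l + (star (ψ' l) ⬝ᵥ ψ) • ψ)) k * star ((Wᴴ *ᵥ ψ) k)).im := by
    intro u k
    have e : (∑ l, (u l : ℂ) • ψ' l) + (star (∑ l, (u l : ℂ) • ψ' l) ⬝ᵥ ψ) • ψ =
        ∑ l, (u l : ℂ) • (ψ' l + (star (ψ' l) ⬝ᵥ ψ) • ψ) := by
      simp only [star_sum, star_smul, sum_dotProduct, smul_dotProduct, smul_eq_mul, Complex.star_def,
        Complex.conj_ofReal, smul_add, Finset.sum_add_distrib, Finset.sum_smul, smul_smul]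
    rw [e, mulVec_sum, Finset.sum_apply, Finset.sum_mul, Complex.im_sum]
    refine Finset.sum_congr rfl fun l _ => ?_
    rw [mulVec_smul, Pi.smul_apply, smul_eq_mul, mul_assoc, Complex.im_ofReal_mul]
  constructor
  · intro hIF l k
    -- take `u = e_l`: the gap vanishes, so every square in the sum vanishes
    have hgap := qfim_sub_projFisher_quadratic hW' hψ hp hre hI hF (Pi.single l 1)
    rw [hIF, sub_self] at hgap
    have hsum : ∑ k, ((Wᴴ *ᵥ ((∑ l', ((Pi.single l 1 : ι → ℝ) l' : ℂ) • ψ' l') +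
        (star (∑ l', ((Pi.single l 1 : ι → ℝ) l' : ℂ) • ψ' l') ⬝ᵥ ψ) • ψ)) k * star ((Wᴴ *ᵥ ψ) k)).im ^ 2 /
        Complex.normSq ((Wᴴ *ᵥ ψ) k) = 0 := by linarith
    have hk := (Finset.sum_eq_zero_iff_of_nonneg fun k _ =>
      div_nonneg (sq_nonneg _) (Complex.normSq_nonneg _)).mp hsum k (Finset.mem_univ k)
    rw [div_eq_zero_iff, or_iff_left (Complex.normSq_pos.mpr (hp k)).ne', sq_eq_zero_iff, hlin] at hk
    simpa [Pi.single_apply] using hk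
  · intro hcond
    refine ext_of_dotProduct_mulVec_eq hIh hFh fun u => ?_
    have hgap := qfim_sub_projFisher_quadratic hW' hψ hp hre hI hF u
    have hzero : ∀ k, ((Wᴴ *ᵥ ((∑ l, (u l : ℂ) • ψ' l) + (star (∑ l, (u l : ℂ) • ψ' l) ⬝ᵥ ψ) • ψ)) k *
        star ((Wᴴ *ᵥ ψ) k)).im = 0 := fun k => by
      rw [hlin]
      exact Finset.sum_eq_zero fun l _ => by rw [hcond l k, mul_zero]
    simp_rw [hzero] at hgap
    simp only [ne_eq, OfNat.ofNat_ne_zero, not_false_eq_true, zero_pow, zero_div, Finset.sum_const_zero,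
      mul_zero] at hgap
    linarith

omit [DecidableEq n] in
/-- The two printed forms of the condition agree: `Im[⟨Υ_k|ω_l⟩⟨ψ|Υ_k⟩] = 0` iff
`Im[⟨∂_lψ|Υ_k⟩⟨Υ_k|ψ⟩] = |⟨ψ|Υ_k⟩|²Im[⟨∂_lψ|ψ⟩]`. [cite: PezzeEtAl2017, Appendix proof of Thm 2 («or, equivalently»)] -/
theorem im_amp_omega_eq_zero_iff (W : Matrix n n ℂ) (ψ ψ' : n → ℂ) (k : n) :
    ((Wᴴ *ᵥ (ψ' + (star ψ' ⬝ᵥ ψ) • ψ)) k * star ((Wᴴ *ᵥ ψ) k)).im = 0 ↔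
      (star ((Wᴴ *ᵥ ψ') k) * (Wᴴ *ᵥ ψ) k).im = Complex.normSq ((Wᴴ *ᵥ ψ) k) * (star ψ' ⬝ᵥ ψ).im := by
  have h1 : ((Wᴴ *ᵥ (ψ' + (star ψ' ⬝ᵥ ψ) • ψ)) k * star ((Wᴴ *ᵥ ψ) k)).im =
      ((Wᴴ *ᵥ ψ') k * star ((Wᴴ *ᵥ ψ) k)).im + Complex.normSq ((Wᴴ *ᵥ ψ) k) * (star ψ' ⬝ᵥ ψ).im := by
    rw [mulVec_add, mulVec_smul, Pi.add_apply, Pi.smul_apply, smul_eq_mul, add_mul, mul_assoc, mul_star_self,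
      Complex.add_im, Complex.im_mul_ofReal, mul_comm (star ψ' ⬝ᵥ ψ).im]
  have h2 : (star ((Wᴴ *ᵥ ψ') k) * (Wᴴ *ᵥ ψ) k).im = -((Wᴴ *ᵥ ψ') k * star ((Wᴴ *ᵥ ψ) k)).im := by
    have e : star ((Wᴴ *ᵥ ψ') k) * (Wᴴ *ᵥ ψ) k = conj ((Wᴴ *ᵥ ψ') k * star ((Wᴴ *ᵥ ψ) k)) := by
      rw [map_mul, Complex.star_def, Complex.conj_conj]
    rw [e, Complex.conj_im]
  rw [h1, h2]
  constructor <;> intro h <;> linarith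

/-- **Theorem 2 (Pezzè et al. 2017; Liu–Yuan–Lu–Wang Thm 3.4), printed form**: for a pure state `|ψ⟩`,
derivative vectors with `⟨ψ|∂_lψ⟩ + ⟨∂_lψ|ψ⟩ = 0`, and a complete set of projectors `{|Υ_k⟩⟨Υ_k|}` (columns of
a unitary `W`) with `⟨Υ_k|ψ⟩ ≠ 0` for all `k`: the outcome Fisher matrix equals the QFIM, `F = F_Q`, if and
only if `Im[⟨∂_lψ|Υ_k⟩⟨Υ_k|ψ⟩] = |⟨ψ|Υ_k⟩|² Im[⟨∂_lψ|ψ⟩]` for all `l` and `k`.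
[cite: PezzeEtAl2017, Thm 2] [cite: LiuYuanLuWang2020, §3.1.3 Thm 3.4] -/
theorem projFisher_eq_qfim_iff' [DecidableEq ι] {W : Matrix n n ℂ} (hW' : W * Wᴴ = 1) {ψ : n → ℂ}
    (hψ : star ψ ⬝ᵥ ψ = 1) (hp : ∀ k, (Wᴴ *ᵥ ψ) k ≠ 0) {ψ' : ι → n → ℂ}
    (hre : ∀ l, star ψ ⬝ᵥ ψ' l + star (ψ' l) ⬝ᵥ ψ = 0) {I F : Matrix ι ι ℝ}
    (hI : ∀ l m, I l m = ∑ k, (2 * ((Wᴴ *ᵥ ψ' l) k * star ((Wᴴ *ᵥ ψ) k)).re) *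
      (2 * ((Wᴴ *ᵥ ψ' m) k * star ((Wᴴ *ᵥ ψ) k)).re) / Complex.normSq ((Wᴴ *ᵥ ψ) k))
    (hF : ∀ l m, F l m = 4 * (star (ψ' l) ⬝ᵥ ψ' m - (star (ψ' l) ⬝ᵥ ψ) * (star ψ ⬝ᵥ ψ' m)).re) :
    I = F ↔ ∀ l k, (star ((Wᴴ *ᵥ ψ' l) k) * (Wᴴ *ᵥ ψ) k).im =
      Complex.normSq ((Wᴴ *ᵥ ψ) k) * (star (ψ' l) ⬝ᵥ ψ).im := by
  rw [projFisher_eq_qfim_iff hW' hψ hp hre hI hF]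
  exact forall_congr' fun l => forall_congr' fun k => im_amp_omega_eq_zero_iff W ψ (ψ' l) k

/-! ## § 5 Bridges to the density-matrix vocabulary (Born probabilities, SLD-QFIM) -/

omit [DecidableEq n] in
/-- **`P(k) = Tr(ρΠ_k) = |⟨Υ_k|ψ⟩|²`** for `ρ = |ψ⟩⟨ψ|`, `Π_k = |Υ_k⟩⟨Υ_k|`. [cite: PezzeEtAl2017, (3) («`P(k|θ) = ⟨ψ_θ|Π̂_k|ψ_θ⟩`»)] -/
theorem re_trace_pure_mul_proj (ψ m : n → ℂ) :
    (vecMulVec ψ (star ψ) * vecMulVec m (star m)).trace.re = Complex.normSq (star m ⬝ᵥ ψ) := by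
  rw [vecMulVec_mul_vecMulVec, trace_vecMulVec, dotProduct_smul, smul_eq_mul, dotProduct_comm ψ (star m)]
  have ha : star ψ ⬝ᵥ m = star (star m ⬝ᵥ ψ) := by rw [← star_dotProduct_star, star_star]
  rw [ha, Complex.star_def, ← Complex.normSq_eq_conj_mul_self, Complex.ofReal_re]

omit [DecidableEq n] in
/-- **`∂_lP(k) = Tr(∂_lρ Π_k) = 2Re[⟨Υ_k|∂_lψ⟩⟨ψ|Υ_k⟩]`** for `∂_lρ = |∂_lψ⟩⟨ψ| + |ψ⟩⟨∂_lψ|`.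
[cite: PezzeEtAl2017, (3) («`∂_lP(k|θ) = 2Re[⟨∂_lψ_θ|Π̂_k|ψ_θ⟩]`»)] -/
theorem re_trace_deriv_mul_proj (ψ ψ' m : n → ℂ) :
    ((vecMulVec ψ' (star ψ) + vecMulVec ψ (star ψ')) * vecMulVec m (star m)).trace.re =
      2 * ((star m ⬝ᵥ ψ') * star (star m ⬝ᵥ ψ)).re := by
  rw [Matrix.add_mul, trace_add, vecMulVec_mul_vecMulVec, vecMulVec_mul_vecMulVec, trace_vecMulVec, trace_vecMulVec,
    dotProduct_smul, dotProduct_smul, smul_eq_mul, smul_eq_mul, dotProduct_comm ψ' (star m), dotProduct_comm ψ (star m)]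
  have ha : star ψ ⬝ᵥ m = star (star m ⬝ᵥ ψ) := by rw [← star_dotProduct_star, star_star]
  have hb : star ψ' ⬝ᵥ m = star (star m ⬝ᵥ ψ') := by rw [← star_dotProduct_star, star_star]
  rw [ha, hb, Complex.add_re]
  have hc : (star (star m ⬝ᵥ ψ') * (star m ⬝ᵥ ψ)).re = ((star m ⬝ᵥ ψ') * star (star m ⬝ᵥ ψ)).re := by
    have e : star (star m ⬝ᵥ ψ') * (star m ⬝ᵥ ψ) = conj ((star m ⬝ᵥ ψ') * star (star m ⬝ᵥ ψ)) := by
      rw [map_mul, Complex.star_def, Complex.conj_conj]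
    rw [e, Complex.conj_re]
  rw [hc, mul_comm (star (star m ⬝ᵥ ψ)) (star m ⬝ᵥ ψ')]
  ring

omit [DecidableEq n] in
/-- With `m = Υ_k` the `k`-th column of `W`: `⟨Υ_k|v⟩ = (W†v)_k`, so the Born data above are the amplitudes used in
this file (`P(k) = |(W†ψ)_k|²`, `∂_lP(k) = 2Re[(W†∂_lψ)_k conj (W†ψ)_k]`). [cite: PezzeEtAl2017, (3)] -/
theorem born_data_eq_amp (W : Matrix n n ℂ) (ψ ψ' : n → ℂ) (k : n) :
    (vecMulVec ψ (star ψ) * vecMulVec (fun j => W j k) (star fun j => W j k)).trace.re =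
        Complex.normSq ((Wᴴ *ᵥ ψ) k) ∧
      ((vecMulVec ψ' (star ψ) + vecMulVec ψ (star ψ')) * vecMulVec (fun j => W j k) (star fun j => W j k)).trace.re =
        2 * ((Wᴴ *ᵥ ψ') k * star ((Wᴴ *ᵥ ψ) k)).re := by
  rw [re_trace_pure_mul_proj, re_trace_deriv_mul_proj, conjTranspose_mulVec_apply, conjTranspose_mulVec_apply]
  exact ⟨rfl, rfl⟩

omit [Fintype ι] in
/-- **The SLD quantum Fisher matrix of `ρ = |ψ⟩⟨ψ|` is `F_Q`**: for any SLDs `S_l` of the pure-state equations,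
`2Re Tr(S_l∂_mρ) = 4Re(⟨∂_lψ|∂_mψ⟩ − ⟨∂_lψ|ψ⟩⟨ψ|∂_mψ⟩)` (g80-#1 `qfim_pure`), so Theorem 2 applies to the QFIM of
`QuantumFisherInformationMatrix.lean` and to the CFIM of `MultiparameterQuantumCramerRaoBound.lean` for the POVM
`Π_k = |Υ_k⟩⟨Υ_k|`. [cite: PezzeEtAl2017, (4) («`F_Q = 4Re[⟨∂_lψ|∂_mψ⟩ − ⟨∂_lψ|ψ⟩⟨ψ|∂_mψ⟩]`»)] -/
theorem qfim_pure_eq {ψ : n → ℂ} {ψ' : ι → n → ℂ} (hψ : star ψ ⬝ᵥ ψ = 1)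
    (hre : ∀ a, star ψ ⬝ᵥ ψ' a + star (ψ' a) ⬝ᵥ ψ = 0) {S : ι → Matrix n n ℂ}
    (hSD : ∀ a, S a * vecMulVec ψ (star ψ) + vecMulVec ψ (star ψ) * S a =
      vecMulVec (ψ' a) (star ψ) + vecMulVec ψ (star (ψ' a)))
    {FQ : Matrix ι ι ℝ}
    (hFQ : ∀ a b, FQ a b = 2 * (S a * (vecMulVec (ψ' b) (star ψ) + vecMulVec ψ (star (ψ' b)))).trace.re)
    (l m : ι) : FQ l m = 4 * (star (ψ' l) ⬝ᵥ ψ' m - (star (ψ' l) ⬝ᵥ ψ) * (star ψ ⬝ᵥ ψ' m)).re :=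
  QFIM.qfim_pure hψ hre hSD hFQ l m

/-! ## § 6 Consistency with Matsumoto's weak commutativity condition (Appendix § 2.1) -/

omit [Fintype ι] in
/-- **The condition of Theorem 2 implies `Im⟨ω_l|ω_m⟩ = 0`**: if `Im[⟨Υ_k|ω_l⟩⟨ψ|Υ_k⟩] = 0` for all `l, k` (and
`⟨Υ_k|ψ⟩ ≠ 0`, `Σ_k|Υ_k⟩⟨Υ_k| = 𝟙`), then `⟨ω_l|ω_m⟩ = Σ_k z̄_{lk}z_{mk}/|⟨Υ_k|ψ⟩|²` is real.
[cite: PezzeEtAl2017, Appendix §2.1 («Eq. (condition) implies Matsumoto's weak commutativity condition»)] -/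
theorem im_inner_omega_omega_eq_zero {W : Matrix n n ℂ} (hW' : W * Wᴴ = 1) {ψ : n → ℂ}
    (hp : ∀ k, (Wᴴ *ᵥ ψ) k ≠ 0) (ω : ι → n → ℂ)
    (hcond : ∀ l k, ((Wᴴ *ᵥ ω l) k * star ((Wᴴ *ᵥ ψ) k)).im = 0) (l l' : ι) :
    (star (ω l) ⬝ᵥ ω l').im = 0 := by
  rw [← sum_star_amp_mul_amp hW' (ω l) (ω l'), Complex.im_sum]
  refine Finset.sum_eq_zero fun k _ => ?_
  have hsk : (Complex.normSq ((Wᴴ *ᵥ ψ) k) : ℂ) ≠ 0 := by exact_mod_cast (Complex.normSq_pos.mpr (hp k)).ne'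
  -- `conj(x) y = conj(x s̄) (y s̄) / |s|²`
  have e : star ((Wᴴ *ᵥ ω l) k) * (Wᴴ *ᵥ ω l') k =
      star ((Wᴴ *ᵥ ω l) k * star ((Wᴴ *ᵥ ψ) k)) * ((Wᴴ *ᵥ ω l') k * star ((Wᴴ *ᵥ ψ) k)) /
        (Complex.normSq ((Wᴴ *ᵥ ψ) k) : ℂ) := by
    rw [eq_div_iff hsk, star_mul, star_star, ← mul_star_self ((Wᴴ *ᵥ ψ) k)]
    ring
  -- two reals
  have hr : ∀ j, (Wᴴ *ᵥ ω j) k * star ((Wᴴ *ᵥ ψ) k) =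
      ((((Wᴴ *ᵥ ω j) k * star ((Wᴴ *ᵥ ψ) k)).re : ℝ) : ℂ) := fun j =>
    Complex.ext (by rw [Complex.ofReal_re]) (by rw [Complex.ofReal_im]; exact hcond j k)
  rw [e, hr l, hr l', Complex.star_def, Complex.conj_ofReal, ← Complex.ofReal_mul, ← Complex.ofReal_div,
    Complex.ofReal_im]

omit [Fintype ι] in
/-- **Hence Matsumoto's weak commutativity `Im⟨∂_lψ|∂_mψ⟩ = 0`** for all `l, m` whenever a complete projective
measurement not orthogonal to the probe satisfies the condition of Theorem 2 (with `|ω_l⟩ = |∂_lψ⟩ + ⟨∂_lψ|ψ⟩|ψ⟩`,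
`⟨ω_l|ω_m⟩ = ⟨∂_lψ|∂_mψ⟩ − ⟨∂_lψ|ψ⟩⟨ψ|∂_mψ⟩` and the subtracted term is real).
[cite: PezzeEtAl2017, Appendix §2.1] [cite: LiuYuanLuWang2020, §3.1.2 Thm 3.2 («`Im(⟨∂_aψ|∂_bψ⟩) = 0`»)] -/
theorem im_inner_deriv_deriv_eq_zero {W : Matrix n n ℂ} (hW' : W * Wᴴ = 1) {ψ : n → ℂ} (hψ : star ψ ⬝ᵥ ψ = 1)
    (hp : ∀ k, (Wᴴ *ᵥ ψ) k ≠ 0) {ψ' : ι → n → ℂ} (hre : ∀ l, star ψ ⬝ᵥ ψ' l + star (ψ' l) ⬝ᵥ ψ = 0)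
    (hcond : ∀ l k, ((Wᴴ *ᵥ (ψ' l + (star (ψ' l) ⬝ᵥ ψ) • ψ)) k * star ((Wᴴ *ᵥ ψ) k)).im = 0) (l l' : ι) :
    (star (ψ' l) ⬝ᵥ ψ' l').im = 0 := by
  have h := im_inner_omega_omega_eq_zero hW' hp (fun j => ψ' j + (star (ψ' j) ⬝ᵥ ψ) • ψ) hcond l l'
  rw [inner_omega_omega hψ (hre l) (hre l')] at h
  obtain ⟨Q, hQ⟩ : ∃ Q : Matrix ι ι ℂ, ∀ a b, Q a b = star (ψ' a) ⬝ᵥ ψ' b - (star (ψ' a) ⬝ᵥ ψ) * (star ψ ⬝ᵥ ψ' b) :=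
    ⟨Matrix.of fun a b => _, fun _ _ => rfl⟩
  rw [← hQ] at h
  rw [← PureQGT.im_qgt_eq hre hQ l l', h]

end Literature.InformationTheory.StateDiscrimination.PureProjective

end
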